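import Literature.NumberTheory.EllipticCurves.MatsunoCurves
import HarnessLib

/-!
# Matsuno 2009, §5: the primes (A1)–(A4) from one Chebotarev statement

`Literature/NumberTheory/EllipticCurves/MatsunoCurves.lean` vendors the existence of Matsuno's primes
`ℓ₁, …, ℓ_k, m₁, …, m_k` with (A1)–(A4) (K. Matsuno, Math. Res. Lett. 16 (2009), §5, p. 456) as
one named fact `Literature.NumberTheory.EllipticCurves.Matsuno2009_exists_primes`, quantified over
the whole `2k`-tuple. The printed justification is a one-prime-at-a-time recipe: "We can indeed
find such primes by using the Chebotarev density theorem. (After taking `m₁, ⋯, m_k` satisfying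
(A2) and (A3), take `ℓ₁ ∤ n` such that the fixed field of the Frobenius element at `ℓ₁` in
`Gal(K(√−1, √m₁, ⋯, √m_k)/ℚ)` is `ℚ(√−1, √m₂, ⋯, √m_k)`, and so on.)" This file isolates the
single instance of the Chebotarev density theorem behind that recipe as the named fact
`Matsuno2009_existsInertPrime` — for `K/ℚ` cyclic of odd degree, distinct odd primes `q_j` and
signs `ε_j`, there are arbitrarily large primes `p ≡ 1 (mod 4)` remaining prime in `K` with
`(q_j / p) = ε_j` — and PROVES `Matsuno2009_exists_primes` from it
(`Matsuno2009_exists_primes_of_existsInertPrime`), following the printed recipe: the `m_j` first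
(the case `r = 0`: inert primes `≡ 1 (mod 4)`, taken `> n`, so (A2)–(A3)), then one prime `ℓ_i`
per index with the sign pattern `(m_j/ℓ_i) = (−1)^{δ_ij}`, taken `> n + Σ m_j` ((A1), (A3),
(A4); the `ℓ_i` are pairwise distinct since `(m_i/ℓ_i) = −1 ≠ +1 = (m_i/ℓ_{i'})`).

Why the single-prime statement is Chebotarev (Neukirch, *ANT*, VII (13.4)): `K` has odd degree
and `M = ℚ(√−1, √q₁, …, √q_r)` has `2`-power degree, so `K ∩ M = ℚ` and
`Gal(KM/ℚ) = Gal(K/ℚ) × Gal(M/ℚ) ≅ Gal(K/ℚ) × (ℤ/2)^{r+1}` (the classes of `−1, q₁, …, q_r` are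
independent in `ℚ^×/ℚ^{×2}`); infinitely many primes `p` have Frobenius `(σ, +1, ε)` with `σ` a
generator of the cyclic group `Gal(K/ℚ)`, i.e. `p` is unramified and inert in `K` (`p𝓞_K`
prime), `p` splits in `ℚ(√−1)` (`p ≡ 1 (mod 4)`), and the Frobenius of `p` in `ℚ(√q_j)` is
`(q_j/p) = ε_j`. Mathlib has Dirichlet's theorem but neither Chebotarev nor the splitting of
primes in `K(√−1, √q_j)`; the tree's Chebotarev fact over `ℚ`
(`Literature.NumberTheory.LFunctions.Chebotarev.dirichletDensity_eq`, `Γ_ℚ`-language) is the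
intended upstream of a discharge.

## References

* K. Matsuno, Math. Res. Lett. 16 (2009), no. 3, 449–461, §5 (p. 456). [Matsuno2009]
* J. Neukirch, *Algebraic Number Theory* (1999), Ch. VII, Thm. (13.4). [NeukirchANT1999]
-/

noncomputable section

open scoped Classical NumberField

open Finset

namespace Literature.NumberTheory.EllipticCurves

/-- **The Chebotarev step of Matsuno §5 (named fact).** Let `K/ℚ` be a cyclic Galois extension
of odd degree, `q₁, …, q_r` distinct odd primes and `ε₁, …, ε_r ∈ {±1}`. Then for every `N`
there is a prime `p > N` with `p ≡ 1 (mod 4)`, `p𝓞_K` a prime ideal ("`p` remains prime in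
`K`", (A3)), and Legendre symbols `(q_j / p) = ε_j` (`jacobiSym (q_j) p`) for all `j` — the
instance of the Chebotarev density theorem for `K(√−1, √q₁, …, √q_r)/ℚ` and the Frobenius class
`(generator of Gal(K/ℚ), +1, ε)` used on p. 456 ("take `ℓ₁ ∤ n` such that the fixed field of
the Frobenius element at `ℓ₁` in `Gal(K(√−1, √m₁, ⋯, √m_k)/ℚ)` is `ℚ(√−1, √m₂, ⋯, √m_k)`, and so
on"; the case `r = 0` supplies the `m_j`). See the module docstring for the linear-disjointness
argument. [cite: Matsuno2009, §5 (p. 456), via NeukirchANT1999 VII (13.4)] -/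
def Matsuno2009_existsInertPrime : Prop :=
  ∀ (K : Type) [Field K] [NumberField K] [IsGalois ℚ K] [IsCyclic (K ≃ₐ[ℚ] K)],
    Odd (Module.finrank ℚ K) →
    ∀ (r : ℕ) (q : Fin r → ℕ), (∀ j, (q j).Prime) → (∀ j, Odd (q j)) → Function.Injective q →
    ∀ (ε : Fin r → ℤ), (∀ j, ε j = 1 ∨ ε j = -1) →
    ∀ N : ℕ, ∃ p : ℕ, N < p ∧ p.Prime ∧ p % 4 = 1 ∧
      (Ideal.span ({(p : 𝓞 K)} : Set (𝓞 K))).IsPrime ∧ ∀ j, jacobiSym (q j) p = ε j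

/-- **`Matsuno2009_exists_primes` from the Chebotarev step**, following the printed recipe
(p. 456): the `m_j` are `k` distinct primes `≡ 1 (mod 4)` (hence odd), inert in `K` and `> n`
(so `m_j ∤ n`: (A2), (A3)); then, for each `i`, `ℓ_i` is a prime `> n + Σ_j m_j` (so `ℓ_i ∤ n`,
`ℓ_i ≠ m_j`), `≡ 1 (mod 4)`, inert in `K`, with `(m_j / ℓ_i) = (−1)^{δ_ij}` ((A1), (A3), (A4));
`ℓ_i ≠ ℓ_{i'}` for `i ≠ i'` because `(m_i/ℓ_i) = −1` while `(m_i/ℓ_{i'}) = 1`.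
[cite: Matsuno2009, §5 (p. 456)] -/
theorem Matsuno2009_exists_primes_of_existsInertPrime (hC : Matsuno2009_existsInertPrime) :
    Matsuno2009_exists_primes := by
  intro n hn K _ _ _ _ hK k
  have hodd : Odd (Module.finrank ℚ K) := hK ▸ hn
  have hn0 : 0 < n := hn.pos
  -- Step 1 (A2), (A3): the primes `m_j` — inert, `≡ 1 (mod 4)`, larger than `n`.
  set S : Set ℕ := {p : ℕ | p.Prime ∧ p % 4 = 1 ∧
    (Ideal.span ({(p : 𝓞 K)} : Set (𝓞 K))).IsPrime ∧ n < p} with hS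
  have hSinf : S.Infinite := by
    refine Set.infinite_of_forall_exists_gt fun N => ?_
    obtain ⟨p, hNp, hp, hp4, hpK, -⟩ := hC K hodd 0 Fin.elim0 (fun j => j.elim0)
      (fun j => j.elim0) (fun a _ _ => a.elim0) Fin.elim0 (fun j => j.elim0) (max N n)
    exact ⟨p, ⟨hp, hp4, hpK, lt_of_le_of_lt (le_max_right _ _) hNp⟩,
      lt_of_le_of_lt (le_max_left _ _) hNp⟩
  let e : ℕ ↪ S := hSinf.natEmbedding
  let m : Fin k → ℕ := fun j => (e j : ℕ)
  have hm : ∀ j, (m j).Prime ∧ m j % 4 = 1 ∧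
      (Ideal.span ({(m j : 𝓞 K)} : Set (𝓞 K))).IsPrime ∧ n < m j := fun j => (e j).2
  have hminj : Function.Injective m := fun i j hij =>
    Fin.val_injective (e.injective (Subtype.val_injective hij))
  have hmodd : ∀ j, Odd (m j) := fun j => by
    rw [Nat.odd_iff]; have := (hm j).2.1; omega
  -- Step 2 (A1), (A3), (A4): the primes `ℓ_i`, one Chebotarev prime for each `i`.
  have hℓ : ∀ i : Fin k, ∃ p : ℕ, (n + ∑ j, m j) < p ∧ p.Prime ∧ p % 4 = 1 ∧
      (Ideal.span ({(p : 𝓞 K)} : Set (𝓞 K))).IsPrime ∧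
        ∀ j, jacobiSym (m j) p = if i = j then -1 else 1 := by
    intro i
    obtain ⟨p, hNp, hp, hp4, hpK, hJ⟩ := hC K hodd k m (fun j => (hm j).1) hmodd hminj
      (fun j => if i = j then -1 else 1) (fun j => by by_cases h : i = j <;> simp [h])
      (n + ∑ j, m j)
    exact ⟨p, hNp, hp, hp4, hpK, hJ⟩
  choose ℓ hℓN hℓp hℓ4 hℓK hℓJ using hℓ
  have hℓ_gt_n : ∀ i, n < ℓ i := fun i => lt_of_le_of_lt (Nat.le_add_right _ _) (hℓN i)
  have hℓ_gt_m : ∀ i j, m j < ℓ i := fun i j =>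
    lt_of_le_of_lt ((Finset.single_le_sum (fun j _ => Nat.zero_le (m j)) (Finset.mem_univ j)).trans
      (Nat.le_add_left _ _)) (hℓN i)
  have hℓinj : Function.Injective ℓ := by
    intro i i' h
    by_contra hii'
    have h1 := hℓJ i i
    have h2 := hℓJ i' i
    rw [if_pos rfl] at h1
    rw [if_neg (Ne.symm hii'), ← h, h1] at h2
    norm_num at h2
  exact ⟨ℓ, m, hℓp, fun j => (hm j).1, hℓ4,
    fun i h => absurd (Nat.le_of_dvd hn0 h) (not_le.mpr (hℓ_gt_n i)),
    fun j h => absurd (Nat.le_of_dvd hn0 h) (not_le.mpr (hm j).2.2.2), hmodd, hℓinj, hminj,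
    fun i j => (hℓ_gt_m i j).ne', hℓK, fun j => (hm j).2.2.1, fun i j => hℓJ i j⟩

/-- **Matsuno's parameters exist from the Chebotarev step and Lemma 5.2** (the two genuinely
external existence inputs), for `K/ℚ` cyclic of odd degree `n` and every `k`
(`MatsunoParams.nonempty_of` with `Matsuno2009_exists_primes_of_existsInertPrime`).
[cite: Matsuno2009, §5 (p. 456) and Lemma 5.2] -/
theorem MatsunoParams.nonempty_of_existsInertPrime (hC : Matsuno2009_existsInertPrime)
    (h52 : Matsuno2009_lemma52) (n : ℕ) (hn : Odd n) (K : Type) [Field K] [NumberField K]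
    [IsGalois ℚ K] [IsCyclic (K ≃ₐ[ℚ] K)] (hK : Module.finrank ℚ K = n) (k : ℕ) :
    Nonempty (MatsunoParams K n k) :=
  MatsunoParams.nonempty_of (Matsuno2009_exists_primes_of_existsInertPrime hC) h52 n hn K hK k

end Literature.NumberTheory.EllipticCurves

end
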